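import Summits.QuantumFields.YangMills.Theorems.BalabanUVNodesN11OpenLocusTruncationDefs
import Summits.QuantumFields.YangMills.Theorems.BalabanUVNodesN11FluctTruncationDefs

/-!
# DAG node N11 — DEFINITIONS: THE SPACE TRUNCATION OF §2 TERM VALUES (`spaceTrunc`), THE TRANSPORT OF r11's LAW PACKAGES, AND THE TERM ROWS AS
# THEOREMS — door (d4), part 2 of 2

HEADER — WORK-UNIT METADATA.  Cell `pub-ymgap`, YM-PLAN Track A (HUMAN RULING D-0062), seat `pub-ymgap-dag-n11-d` (g11; R134 fan-out seat N11 [B14], strategy s2),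
route `BalabanUVNodes`, item K1⁷ `StabilityBAtRecordR13SepCoPH` = stmt-QuantumFields-20542; DEFINITION lane (`--kind definition --supports 20542 --as helper`),
count-neutral.  [III] = [Balaban1988Convergent], [I] = [Balaban1987RG1].  Over part 1 (`…N11OpenLocusTruncationDefs`: `truncC` and its locality ∕ gauge faces),
11b ∕ 11c (`Sect2.TermValues`, `Sect2.towerOfTerms`, `Sect2.spaceI ∕ spaceMS`, `Sect2.LawsRT ∕ LawsT`), r11 (`Step.LFHyp`, `LFHypImproved`, `LFNewTerms`,
`B14.Eq227LocalizedTerms.LFHypAnalytic`) and this seat's g10 `…N11FluctTruncationDefs` (`IsFluctLocal`).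

WHY THIS FILE.  See part 1: the six «term rows» of p586165 sit on an ∃-bound witness and are dischargeable only from its LAWS.  `spaceTrunc S n₀ t` replaces,
at the levels `1 ≤ j ≤ n₀`, every term value by its open-locus truncation at a threshold strictly above its law bound (`𝐄`: `E₀e^{−κd_j(X)}`; `𝐑`:
`g_j^{κ₀}e^{−κd_j(X)}`; `𝐁`, per fluctuation datum: `B₀e^{−κd_j(X)}`; the improved rate `(1+4β)κ` of p. 262 included) and zeroes the other levels.  The truncated
family obeys every law the original obeys (§2), agrees with it wherever the laws speak (`…_eq_of_mem`, used by the proof-lane sequel on the configurations 11a's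
`𝐓_n(s)` reads), and its terms are Borel along any continuous background map (the `𝐁`-terms per fluctuation datum) and uniformly bounded (§3) — FIVE of the six
rows as theorems; the JOINT measurability of `𝐁` in `(U, A)` is not reachable (r11's `LFHypAnalytic.analyticB` is per fixed `a` — LOCATED, said).
DECLARED (0 `sorry`): §1 `thr` (`lt_thr_left ∕ _right`, `thr_nonneg`), **`spaceTrunc S n₀ t`**, the faces `spaceTrunc_E∕R∕B_of ∕ _of_not ∕ _eq_of_mem`,
`norm_spaceTrunc_E∕R∕B_le`; §2 `lfHyp_spaceTrunc`, `lfHypAnalytic_spaceTrunc(_of_lt)`, `lfHypImproved_spaceTrunc`, `lfNewTerms_spaceTrunc`, ★★ `lawsRT_spaceTrunc`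
(`k ≤ n₀`), ★★ `lawsT_spaceTrunc` (`k + 1 ≤ n₀`), `universalE_spaceTrunc`, `isFluctLocal_spaceTrunc`; §3 ★ `measurable_re_spaceTrunc_E∕R∕B_comp`,
★ `exists_bound_spaceTrunc_E∕R∕B`.

HONEST FRAMING.  Helper lane of K1⁷; an OPERATION ON WITNESSES + r11's law packages read clause by clause; nothing of Bałaban's is asserted.  N11 NOT discharged;
K1⁷ NOT closed; counts unmoved (typed 28∕28 · discharged 5∕27).  One finite four-torus programme at fixed `ε = L^{−K}` — NOT ℝ⁴, NOT OS, NOT a mass gap, NOT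
Clay.  No `sorry`, `axiom`, `instance`, `notation`.  Sources (SHAPE only): [III] (2.23) p.258, (2.26)–(2.28) p.259, (2.30)–(2.31) p.260, (2.34)–(2.42) p.261,
§2 p.262, §3 p.279; [I] (1.10)–(1.16) p.262.
-/

noncomputable section

open MeasureTheory Set Filter Topology
open scoped BigOperators

universe u

namespace Summit.QuantumFields.YangMills.Theorems.BalabanUVNodesN11SpaceTruncationDefs

open Literature.MathematicalPhysics.QuantumFieldTheory.Balaban1983to89 T4Continuum Node00 Node00.Tk
open Step B14.Eq227LocalizedTerms
open BalabanUVNodesN11FluctTruncationDefs (IsFluctLocal)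
open BalabanUVNodesN11OpenLocusTruncationDefs

/-! ## §1  The thresholds and the space truncation of term values -/

section Trunc

/-- **THE TRUNCATION THRESHOLD** for a law bound `b·e^{−κd}`: strictly above r11's ordinary bound `b·exp(−κ·d)` AND the improved one
`b·exp(−(1+4β)κ·d)` (p. 262), and at least `1` (sign-free). [cite: Balaban1988Convergent, (2.27)(iv) p.259, (2.31) p.260, (2.42) p.261, §2 p.262] -/
def thr (c : LFConsts) (βc b d : ℝ) : ℝ :=
  max (max (b * Real.exp (-c.κ * d)) (b * Real.exp (-((1 + 4 * βc) * c.κ) * d))) 0 + 1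

/-- The ordinary bound is strictly below the threshold. [cite: Balaban1988Convergent, (2.27)(iv) p.259 (bookkeeping)] -/
theorem lt_thr_left (c : LFConsts) (βc b d : ℝ) : b * Real.exp (-c.κ * d) < thr c βc b d :=
  lt_of_le_of_lt ((le_max_left _ _).trans (le_max_left _ _)) (lt_add_one _)

/-- The improved bound is strictly below the threshold. [cite: Balaban1988Convergent, §2 p.262 (bookkeeping)] -/
theorem lt_thr_right (c : LFConsts) (βc b d : ℝ) : b * Real.exp (-((1 + 4 * βc) * c.κ) * d) < thr c βc b d :=
  lt_of_le_of_lt ((le_max_right _ _).trans (le_max_left _ _)) (lt_add_one _)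

/-- The threshold is nonnegative (indeed `≥ 1`). [cite: Balaban1988Convergent, (2.27)(iv) p.259 (bookkeeping)] -/
theorem thr_nonneg (c : LFConsts) (βc b d : ℝ) : 0 ≤ thr c βc b d := by
  unfold thr; linarith [le_max_right (max (b * Real.exp (-c.κ * d)) (b * Real.exp (-((1 + 4 * βc) * c.κ) * d))) 0]

variable {P : Params} {𝔸 : Type*} [NormedRing 𝔸] [NormedAlgebra ℂ 𝔸] {V : Type u} {M : ℕ} {G : Type*} [GaugeGroup G]

/-- **THE SPACE TRUNCATION OF TERM VALUES** `spaceTrunc S n₀ t`: at the levels `1 ≤ j ≤ n₀` every term is replaced by its open-locus truncation at the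
threshold of its law bound (`𝐄`: `E₀e^{−κd_j(X)}`; `𝐑`: `g_j^{κ₀}e^{−κd_j(X)}`; `𝐁`, per fluctuation datum: `B₀e^{−κd_j(X)}`); the other levels are zeroed.  An
OPERATION ON WITNESSES (print's terms are analytic on their spaces; the §2 witness is existential). [cite: Balaban1988Convergent, (2.27)(ii),(iv) p.259, (2.30)–(2.31) p.260, (2.41)(ii), (2.42) p.261] -/
def spaceTrunc (S : Sect2.Setting 𝔸 G) (n₀ : ℕ) (t : Sect2.TermValues P 𝔸 V M) : Sect2.TermValues P 𝔸 V M where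
  E := fun j X z g φ => if 1 ≤ j ∧ j ≤ n₀ then truncC (thr S.lf S.βc S.lf.E₀ ((Sect2.domSys P M j).dj X)) (t.E j X z g) φ else 0
  R := fun j X φ => if 1 ≤ j ∧ j ≤ n₀ then truncC (thr S.lf S.βc (S.flow.g j ^ S.lf.κ₀) ((Sect2.domSys P M j).dj X)) (t.R j X) φ else 0
  B := fun j X φ a => if 1 ≤ j ∧ j ≤ n₀ then truncC (thr S.lf S.βc S.lf.B₀ ((Sect2.domSys P M j).dj X)) (fun ψ => t.B j X ψ a) φ else 0

variable (S : Sect2.Setting 𝔸 G) (n₀ : ℕ) (t : Sect2.TermValues P 𝔸 V M)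

/-- The `𝐄`-terms in the window, unfolded. [cite: Balaban1988Convergent, (2.26)–(2.27) p.259 (bookkeeping)] -/
theorem spaceTrunc_E_of {j : ℕ} (hj : 1 ≤ j ∧ j ≤ n₀) (X : (Sect2.domSys P M j).Dom) (z : Site P j) (g : ℝ) (φ : Sect2.CPair P 𝔸) :
    (spaceTrunc S n₀ t).E j X z g φ = truncC (thr S.lf S.βc S.lf.E₀ ((Sect2.domSys P M j).dj X)) (t.E j X z g) φ := if_pos hj

/-- The `𝐄`-terms off the window vanish. [cite: Balaban1988Convergent, (2.26)–(2.27) p.259 (bookkeeping)] -/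
theorem spaceTrunc_E_of_not {j : ℕ} (hj : ¬ (1 ≤ j ∧ j ≤ n₀)) (X : (Sect2.domSys P M j).Dom) (z : Site P j) (g : ℝ) (φ : Sect2.CPair P 𝔸) :
    (spaceTrunc S n₀ t).E j X z g φ = 0 := if_neg hj

/-- The `𝐑`-terms in the window, unfolded. [cite: Balaban1988Convergent, (2.30) p.260 (bookkeeping)] -/
theorem spaceTrunc_R_of {j : ℕ} (hj : 1 ≤ j ∧ j ≤ n₀) (X : (Sect2.domSys P M j).Dom) (φ : Sect2.CPair P 𝔸) :
    (spaceTrunc S n₀ t).R j X φ = truncC (thr S.lf S.βc (S.flow.g j ^ S.lf.κ₀) ((Sect2.domSys P M j).dj X)) (t.R j X) φ := if_pos hj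

/-- The `𝐑`-terms off the window vanish. [cite: Balaban1988Convergent, (2.30) p.260 (bookkeeping)] -/
theorem spaceTrunc_R_of_not {j : ℕ} (hj : ¬ (1 ≤ j ∧ j ≤ n₀)) (X : (Sect2.domSys P M j).Dom) (φ : Sect2.CPair P 𝔸) :
    (spaceTrunc S n₀ t).R j X φ = 0 := if_neg hj

/-- The `𝐁`-terms in the window, unfolded. [cite: Balaban1988Convergent, (2.40)–(2.41) p.261 (bookkeeping)] -/
theorem spaceTrunc_B_of {j : ℕ} (hj : 1 ≤ j ∧ j ≤ n₀) (X : (Sect2.domSys P M j).Dom) (φ : Sect2.CPair P 𝔸) (a : SFluct P V) :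
    (spaceTrunc S n₀ t).B j X φ a = truncC (thr S.lf S.βc S.lf.B₀ ((Sect2.domSys P M j).dj X)) (fun ψ => t.B j X ψ a) φ := if_pos hj

/-- The `𝐁`-terms off the window vanish. [cite: Balaban1988Convergent, (2.40)–(2.41) p.261 (bookkeeping)] -/
theorem spaceTrunc_B_of_not {j : ℕ} (hj : ¬ (1 ≤ j ∧ j ≤ n₀)) (X : (Sect2.domSys P M j).Dom) (φ : Sect2.CPair P 𝔸) (a : SFluct P V) :
    (spaceTrunc S n₀ t).B j X φ a = 0 := if_neg hj

/-- **ON ITS LOCUS A TRUNCATED 𝐄-TERM IS THE 𝐄-TERM** (in the window). [cite: Balaban1988Convergent, (2.27)(ii),(iv) p.259] -/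
theorem spaceTrunc_E_eq_of_mem {j : ℕ} (hj : 1 ≤ j ∧ j ≤ n₀) (X : (Sect2.domSys P M j).Dom) (z : Site P j) (g : ℝ) {φ : Sect2.CPair P 𝔸}
    (ha : AnalyticAt ℂ (t.E j X z g) φ) (hb : ‖t.E j X z g φ‖ < thr S.lf S.βc S.lf.E₀ ((Sect2.domSys P M j).dj X)) :
    (spaceTrunc S n₀ t).E j X z g φ = t.E j X z g φ := by
  rw [spaceTrunc_E_of S n₀ t hj]; exact truncC_of_mem ⟨ha, hb⟩

/-- **ON ITS LOCUS A TRUNCATED 𝐑-TERM IS THE 𝐑-TERM**. [cite: Balaban1988Convergent, (2.30)–(2.31) p.260] -/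
theorem spaceTrunc_R_eq_of_mem {j : ℕ} (hj : 1 ≤ j ∧ j ≤ n₀) (X : (Sect2.domSys P M j).Dom) {φ : Sect2.CPair P 𝔸} (ha : AnalyticAt ℂ (t.R j X) φ)
    (hb : ‖t.R j X φ‖ < thr S.lf S.βc (S.flow.g j ^ S.lf.κ₀) ((Sect2.domSys P M j).dj X)) : (spaceTrunc S n₀ t).R j X φ = t.R j X φ := by
  rw [spaceTrunc_R_of S n₀ t hj]; exact truncC_of_mem ⟨ha, hb⟩

/-- **ON ITS LOCUS A TRUNCATED 𝐁-TERM IS THE 𝐁-TERM**. [cite: Balaban1988Convergent, (2.41)(ii), (2.42) p.261] -/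
theorem spaceTrunc_B_eq_of_mem {j : ℕ} (hj : 1 ≤ j ∧ j ≤ n₀) (X : (Sect2.domSys P M j).Dom) {φ : Sect2.CPair P 𝔸} (a : SFluct P V)
    (ha : AnalyticAt ℂ (fun ψ => t.B j X ψ a) φ) (hb : ‖t.B j X φ a‖ < thr S.lf S.βc S.lf.B₀ ((Sect2.domSys P M j).dj X)) :
    (spaceTrunc S n₀ t).B j X φ a = t.B j X φ a := by
  rw [spaceTrunc_B_of S n₀ t hj]; exact truncC_of_mem (f := fun ψ => t.B j X ψ a) ⟨ha, hb⟩

/-- `‖𝐄‖` of the truncated family is bounded by the threshold (every level). [cite: Balaban1988Convergent, (2.27)(iv) p.259 (bookkeeping)] -/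
theorem norm_spaceTrunc_E_le (j : ℕ) (X : (Sect2.domSys P M j).Dom) (z : Site P j) (g : ℝ) (φ : Sect2.CPair P 𝔸) :
    ‖(spaceTrunc S n₀ t).E j X z g φ‖ ≤ thr S.lf S.βc S.lf.E₀ ((Sect2.domSys P M j).dj X) := by
  by_cases hj : 1 ≤ j ∧ j ≤ n₀
  · rw [spaceTrunc_E_of S n₀ t hj]; exact norm_truncC_le (thr_nonneg _ _ _ _) _ _
  · rw [spaceTrunc_E_of_not S n₀ t hj, norm_zero]; exact thr_nonneg _ _ _ _

/-- `‖𝐑‖` of the truncated family is bounded by the threshold. [cite: Balaban1988Convergent, (2.31) p.260 (bookkeeping)] -/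
theorem norm_spaceTrunc_R_le (j : ℕ) (X : (Sect2.domSys P M j).Dom) (φ : Sect2.CPair P 𝔸) :
    ‖(spaceTrunc S n₀ t).R j X φ‖ ≤ thr S.lf S.βc (S.flow.g j ^ S.lf.κ₀) ((Sect2.domSys P M j).dj X) := by
  by_cases hj : 1 ≤ j ∧ j ≤ n₀
  · rw [spaceTrunc_R_of S n₀ t hj]; exact norm_truncC_le (thr_nonneg _ _ _ _) _ _
  · rw [spaceTrunc_R_of_not S n₀ t hj, norm_zero]; exact thr_nonneg _ _ _ _

/-- `‖𝐁‖` of the truncated family is bounded by the threshold. [cite: Balaban1988Convergent, (2.42) p.261 (bookkeeping)] -/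
theorem norm_spaceTrunc_B_le (j : ℕ) (X : (Sect2.domSys P M j).Dom) (φ : Sect2.CPair P 𝔸) (a : SFluct P V) :
    ‖(spaceTrunc S n₀ t).B j X φ a‖ ≤ thr S.lf S.βc S.lf.B₀ ((Sect2.domSys P M j).dj X) := by
  by_cases hj : 1 ≤ j ∧ j ≤ n₀
  · rw [spaceTrunc_B_of S n₀ t hj]; exact norm_truncC_le (thr_nonneg _ _ _ _) _ _
  · rw [spaceTrunc_B_of_not S n₀ t hj, norm_zero]; exact thr_nonneg _ _ _ _

end Trunc

/-! ## §2  Transport of r11's law packages along the space truncation -/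

section Laws

variable {P : Params} {𝔸 : Type*} [NormedRing 𝔸] [NormedAlgebra ℂ 𝔸] [CompleteSpace 𝔸] {V : Type u} {M : ℕ} {G : Type*} [GaugeGroup G]
variable (S : Sect2.Setting 𝔸 G) (Rz : Sect2.Residual P 𝔸) (Ω : ℕ → Set (Site P 0)) (t : Sect2.TermValues P 𝔸 V M)

/-- **r11's INDUCTIVE BOUNDS TRANSPORT** to the truncated family at every index `k ≤ n₀`, GIVEN the analyticity clause at the same index (the spaces lie in the
loci: analytic by (ii), below threshold by (iv) ∕ (2.31) ∕ (2.42)); locality (i) and gauge invariance (iii) pass to the loci (§2, §3).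
[cite: Balaban1988Convergent, (2.27)(i)–(iv) p.259, (2.31) p.260, (2.42) p.261] -/
theorem lfHyp_spaceTrunc {k n₀ : ℕ} (hk : k ≤ n₀) (h : LFHyp (Sect2.towerOfTerms S Rz M Ω t) S.lf k)
    (ha : LFHypAnalytic (Sect2.towerOfTerms S Rz M Ω t) S.lf k) : LFHyp (Sect2.towerOfTerms S Rz M Ω (spaceTrunc S n₀ t)) S.lf k where
  rg := h.rg
  localDepE := fun j h1 hj X z g φ ψ hφψ => by
    show (spaceTrunc S n₀ t).E j X z g φ = (spaceTrunc S n₀ t).E j X z g ψ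
    rw [spaceTrunc_E_of S n₀ t ⟨h1, hj.trans hk⟩, spaceTrunc_E_of S n₀ t ⟨h1, hj.trans hk⟩]
    exact truncC_congr_of_agreeOnSet (fun φ' ψ' h' => h.localDepE j h1 hj X z g φ' ψ' h') _ hφψ
  localDepR := fun j h1 hj X φ ψ hφψ => by
    show (spaceTrunc S n₀ t).R j X φ = (spaceTrunc S n₀ t).R j X ψ
    rw [spaceTrunc_R_of S n₀ t ⟨h1, hj.trans hk⟩, spaceTrunc_R_of S n₀ t ⟨h1, hj.trans hk⟩]
    exact truncC_congr_of_agreeOnSet (fun φ' ψ' h' => h.localDepR j h1 hj X φ' ψ' h') _ hφψ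
  boundE := fun j h1 hj X z g φ hg0 hgγ hφ => by
    show ‖(spaceTrunc S n₀ t).E j X z g φ‖ ≤ _
    rw [spaceTrunc_E_eq_of_mem S n₀ t ⟨h1, hj.trans hk⟩ X z g (ha.analyticE j h1 hj X z g hg0 hgγ φ hφ)
      (lt_of_le_of_lt (h.boundE j h1 hj X z g φ hg0 hgγ hφ) (lt_thr_left _ _ _ _))]
    exact h.boundE j h1 hj X z g φ hg0 hgγ hφ
  boundR := fun j h1 hj X φ hφ => by
    show ‖(spaceTrunc S n₀ t).R j X φ‖ ≤ _
    rw [spaceTrunc_R_eq_of_mem S n₀ t ⟨h1, hj.trans hk⟩ X (ha.analyticR j h1 hj X φ hφ)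
      (lt_of_le_of_lt (h.boundR j h1 hj X φ hφ) (lt_thr_left _ _ _ _))]
    exact h.boundR j h1 hj X φ hφ
  boundB := fun j h1 hj X φ a hφ => by
    show ‖(spaceTrunc S n₀ t).B j X φ a‖ ≤ _
    rw [spaceTrunc_B_eq_of_mem S n₀ t ⟨h1, hj.trans hk⟩ X a (ha.analyticB j h1 hj X a φ hφ)
      (lt_of_le_of_lt (h.boundB j h1 hj X φ a hφ) (lt_thr_left _ _ _ _))]
    exact h.boundB j h1 hj X φ a hφ
  gaugeInvE := fun j h1 hj X z g u φ => by
    show (spaceTrunc S n₀ t).E j X z g (Sect2.cAct (fun x => (u x : 𝔸ˣ)) φ) = (spaceTrunc S n₀ t).E j X z g φ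
    rw [spaceTrunc_E_of S n₀ t ⟨h1, hj.trans hk⟩, spaceTrunc_E_of S n₀ t ⟨h1, hj.trans hk⟩]
    refine truncC_cAct_of_invariant (fun ψ => h.gaugeInvE j h1 hj X z g u ψ) (fun ψ => ?_) _ _
    rw [← coe_inv_gauge u]; exact h.gaugeInvE j h1 hj X z g u⁻¹ ψ
  gaugeInvR := fun j h1 hj X u φ => by
    show (spaceTrunc S n₀ t).R j X (Sect2.cAct (fun x => (u x : 𝔸ˣ)) φ) = (spaceTrunc S n₀ t).R j X φ
    rw [spaceTrunc_R_of S n₀ t ⟨h1, hj.trans hk⟩, spaceTrunc_R_of S n₀ t ⟨h1, hj.trans hk⟩]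
    refine truncC_cAct_of_invariant (fun ψ => h.gaugeInvR j h1 hj X u ψ) (fun ψ => ?_) _ _
    rw [← coe_inv_gauge u]; exact h.gaugeInvR j h1 hj X u⁻¹ ψ

/-- **THE ANALYTICITY CLAUSE TRANSPORTS** at index `k ≤ n₀`, GIVEN strict sub-threshold bounds on the spaces at the same scales (ordinary or improved): the
spaces lie in the loci, on which the truncation is analytic (§1). [cite: Balaban1988Convergent, (2.27)(ii) p.259, (2.30) p.260, (2.41)(ii) p.261] -/
theorem lfHypAnalytic_spaceTrunc_of_lt {k n₀ : ℕ} (hk : k ≤ n₀) (ha : LFHypAnalytic (Sect2.towerOfTerms S Rz M Ω t) S.lf k)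
    (hbE : ∀ j, 1 ≤ j → j ≤ k → ∀ (X : (Sect2.domSys P M j).Dom) (z : Site P j) (g : ℝ) (φ : Sect2.CPair P 𝔸), 0 ≤ g → g ≤ S.lf.γ →
      φ ∈ Sect2.spaceI S Rz M j (Sect2.domSites P M j X) (S.lf.alpha0 (S.flow.g j)) (S.lf.alpha1 (S.flow.g j)) →
        ‖t.E j X z g φ‖ < thr S.lf S.βc S.lf.E₀ ((Sect2.domSys P M j).dj X))
    (hbR : ∀ j, 1 ≤ j → j ≤ k → ∀ (X : (Sect2.domSys P M j).Dom) (φ : Sect2.CPair P 𝔸),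
      φ ∈ Sect2.spaceI S Rz M j (Sect2.domSites P M j X) (S.lf.alpha0 (S.flow.g j)) (S.lf.alpha1 (S.flow.g j)) →
        ‖t.R j X φ‖ < thr S.lf S.βc (S.flow.g j ^ S.lf.κ₀) ((Sect2.domSys P M j).dj X))
    (hbB : ∀ j, 1 ≤ j → j ≤ k → ∀ (X : (Sect2.domSys P M j).Dom) (φ : Sect2.CPair P 𝔸) (a : SFluct P V),
      φ ∈ Sect2.spaceMS S Rz M j (Sect2.domSites P M j X) Ω → ‖t.B j X φ a‖ < thr S.lf S.βc S.lf.B₀ ((Sect2.domSys P M j).dj X)) :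
    LFHypAnalytic (Sect2.towerOfTerms S Rz M Ω (spaceTrunc S n₀ t)) S.lf k where
  analyticE := fun j h1 hj X z g hg0 hgγ => by
    show AnalyticOnNhd ℂ (fun φ => (spaceTrunc S n₀ t).E j X z g φ) _
    simp only [spaceTrunc_E_of S n₀ t ⟨h1, hj.trans hk⟩]
    exact analyticOnNhd_truncC_of_subset (subset_truncLocus_of (ha.analyticE j h1 hj X z g hg0 hgγ) fun φ hφ => hbE j h1 hj X z g φ hg0 hgγ hφ)
  analyticR := fun j h1 hj X => by
    show AnalyticOnNhd ℂ (fun φ => (spaceTrunc S n₀ t).R j X φ) _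
    simp only [spaceTrunc_R_of S n₀ t ⟨h1, hj.trans hk⟩]
    exact analyticOnNhd_truncC_of_subset (subset_truncLocus_of (ha.analyticR j h1 hj X) fun φ hφ => hbR j h1 hj X φ hφ)
  analyticB := fun j h1 hj X a => by
    show AnalyticOnNhd ℂ (fun φ => (spaceTrunc S n₀ t).B j X φ a) _
    simp only [spaceTrunc_B_of S n₀ t ⟨h1, hj.trans hk⟩]
    exact analyticOnNhd_truncC_of_subset (subset_truncLocus_of (ha.analyticB j h1 hj X a) fun φ hφ => hbB j h1 hj X φ a hφ)

/-- The analyticity clause transports at index `k ≤ n₀` given the inductive bounds at the same index. [cite: Balaban1988Convergent, (2.27)(ii),(iv) p.259, (2.30)–(2.31) p.260, (2.41)(ii), (2.42) p.261] -/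
theorem lfHypAnalytic_spaceTrunc {k n₀ : ℕ} (hk : k ≤ n₀) (h : LFHyp (Sect2.towerOfTerms S Rz M Ω t) S.lf k)
    (ha : LFHypAnalytic (Sect2.towerOfTerms S Rz M Ω t) S.lf k) : LFHypAnalytic (Sect2.towerOfTerms S Rz M Ω (spaceTrunc S n₀ t)) S.lf k :=
  lfHypAnalytic_spaceTrunc_of_lt S Rz Ω t hk ha
    (fun j h1 hj X z g φ hg0 hgγ hφ => lt_of_le_of_lt (h.boundE j h1 hj X z g φ hg0 hgγ hφ) (lt_thr_left _ _ _ _))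
    (fun j h1 hj X φ hφ => lt_of_le_of_lt (h.boundR j h1 hj X φ hφ) (lt_thr_left _ _ _ _))
    (fun j h1 hj X φ a hφ => lt_of_le_of_lt (h.boundB j h1 hj X φ a hφ) (lt_thr_left _ _ _ _))

/-- **11c's INDUCTIVE-ASSUMPTION PACKAGE `LawsRT` TRANSPORTS** at every index `k ≤ n₀`. [cite: Balaban1988Convergent, (2.27)–(2.31) pp.259–260, (2.41)–(2.42) p.261] -/
theorem lawsRT_spaceTrunc {k n₀ : ℕ} (hk : k ≤ n₀) (h : Sect2.LawsRT (Sect2.towerOfTerms S Rz M Ω t) S.lf k) :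
    Sect2.LawsRT (Sect2.towerOfTerms S Rz M Ω (spaceTrunc S n₀ t)) S.lf k :=
  ⟨lfHyp_spaceTrunc S Rz Ω t hk h.1 h.2, lfHypAnalytic_spaceTrunc S Rz Ω t hk h.1 h.2⟩

/-- **THE IMPROVED BOUNDS OF THE NEWEST TERMS TRANSPORT** (index `k ≤ n₀`, given analyticity through `k`). [cite: Balaban1988Convergent, §2 p.262] -/
theorem lfHypImproved_spaceTrunc {k n₀ : ℕ} (hk : k ≤ n₀) (h : LFHypImproved (Sect2.towerOfTerms S Rz M Ω t) S.lf S.βc k)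
    (ha : LFHypAnalytic (Sect2.towerOfTerms S Rz M Ω t) S.lf k) : LFHypImproved (Sect2.towerOfTerms S Rz M Ω (spaceTrunc S n₀ t)) S.lf S.βc k where
  boundE := fun h1 X z g φ hg0 hgγ hφ => by
    show ‖(spaceTrunc S n₀ t).E k X z g φ‖ ≤ _
    rw [spaceTrunc_E_eq_of_mem S n₀ t ⟨h1, hk⟩ X z g (ha.analyticE k h1 le_rfl X z g hg0 hgγ φ hφ)
      (lt_of_le_of_lt (h.boundE h1 X z g φ hg0 hgγ hφ) (lt_thr_right _ _ _ _))]
    exact h.boundE h1 X z g φ hg0 hgγ hφ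
  boundR := fun h1 X φ hφ => by
    show ‖(spaceTrunc S n₀ t).R k X φ‖ ≤ _
    rw [spaceTrunc_R_eq_of_mem S n₀ t ⟨h1, hk⟩ X (ha.analyticR k h1 le_rfl X φ hφ)
      (lt_of_le_of_lt (h.boundR h1 X φ hφ) (lt_thr_right _ _ _ _))]
    exact h.boundR h1 X φ hφ
  boundB := fun h1 X φ a hφ => by
    show ‖(spaceTrunc S n₀ t).B k X φ a‖ ≤ _
    rw [spaceTrunc_B_eq_of_mem S n₀ t ⟨h1, hk⟩ X a (ha.analyticB k h1 le_rfl X a φ hφ)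
      (lt_of_le_of_lt (h.boundB h1 X φ a hφ) (lt_thr_right _ _ _ _))]
    exact h.boundB h1 X φ a hφ

/-- **THE NEW-TERM OBLIGATIONS TRANSPORT** (index `k + 1 ≤ n₀`, given analyticity through `k + 1`). [cite: Balaban1988Convergent, §2 p.262] -/
theorem lfNewTerms_spaceTrunc {k n₀ : ℕ} (hk : k + 1 ≤ n₀) (h : LFNewTerms (Sect2.towerOfTerms S Rz M Ω t) S.lf S.βc k)
    (ha : LFHypAnalytic (Sect2.towerOfTerms S Rz M Ω t) S.lf (k + 1)) : LFNewTerms (Sect2.towerOfTerms S Rz M Ω (spaceTrunc S n₀ t)) S.lf S.βc k where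
  rg := h.rg
  localDepE := fun X z g φ ψ hφψ => by
    show (spaceTrunc S n₀ t).E (k + 1) X z g φ = (spaceTrunc S n₀ t).E (k + 1) X z g ψ
    rw [spaceTrunc_E_of S n₀ t ⟨Nat.succ_pos k, hk⟩, spaceTrunc_E_of S n₀ t ⟨Nat.succ_pos k, hk⟩]
    exact truncC_congr_of_agreeOnSet (fun φ' ψ' h' => h.localDepE X z g φ' ψ' h') _ hφψ
  localDepR := fun X φ ψ hφψ => by
    show (spaceTrunc S n₀ t).R (k + 1) X φ = (spaceTrunc S n₀ t).R (k + 1) X ψ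
    rw [spaceTrunc_R_of S n₀ t ⟨Nat.succ_pos k, hk⟩, spaceTrunc_R_of S n₀ t ⟨Nat.succ_pos k, hk⟩]
    exact truncC_congr_of_agreeOnSet (fun φ' ψ' h' => h.localDepR X φ' ψ' h') _ hφψ
  gaugeInvE := fun X z g u φ => by
    show (spaceTrunc S n₀ t).E (k + 1) X z g (Sect2.cAct (fun x => (u x : 𝔸ˣ)) φ) = (spaceTrunc S n₀ t).E (k + 1) X z g φ
    rw [spaceTrunc_E_of S n₀ t ⟨Nat.succ_pos k, hk⟩, spaceTrunc_E_of S n₀ t ⟨Nat.succ_pos k, hk⟩]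
    refine truncC_cAct_of_invariant (fun ψ => h.gaugeInvE X z g u ψ) (fun ψ => ?_) _ _
    rw [← coe_inv_gauge u]; exact h.gaugeInvE X z g u⁻¹ ψ
  gaugeInvR := fun X u φ => by
    show (spaceTrunc S n₀ t).R (k + 1) X (Sect2.cAct (fun x => (u x : 𝔸ˣ)) φ) = (spaceTrunc S n₀ t).R (k + 1) X φ
    rw [spaceTrunc_R_of S n₀ t ⟨Nat.succ_pos k, hk⟩, spaceTrunc_R_of S n₀ t ⟨Nat.succ_pos k, hk⟩]
    refine truncC_cAct_of_invariant (fun ψ => h.gaugeInvR X u ψ) (fun ψ => ?_) _ _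
    rw [← coe_inv_gauge u]; exact h.gaugeInvR X u⁻¹ ψ
  improved := lfHypImproved_spaceTrunc S Rz Ω t hk h.improved ha

/-- **11c's 𝐓-IMAGE PACKAGE `LawsT` TRANSPORTS** at every index with `k + 1 ≤ n₀` (old bounds from `LFHyp … k`, the newest from the improved clause).
[cite: Balaban1988Convergent, §2 p.262, §3 p.279] -/
theorem lawsT_spaceTrunc {k n₀ : ℕ} (hk : k + 1 ≤ n₀) (h : Sect2.LawsT (Sect2.towerOfTerms S Rz M Ω t) S.lf S.βc k) :
    Sect2.LawsT (Sect2.towerOfTerms S Rz M Ω (spaceTrunc S n₀ t)) S.lf S.βc k := by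
  obtain ⟨hH, hN, hA⟩ := h
  refine ⟨lfHyp_spaceTrunc S Rz Ω t (Nat.le_of_succ_le hk) hH (hA.mono (Nat.le_succ k)), lfNewTerms_spaceTrunc S Rz Ω t hk hN hA,
    lfHypAnalytic_spaceTrunc_of_lt S Rz Ω t hk hA ?_ ?_ ?_⟩
  · intro j h1 hj X z g φ hg0 hgγ hφ
    rcases Nat.lt_succ_iff_lt_or_eq.mp (Nat.lt_succ_of_le hj) with hjk | rfl
    · exact lt_of_le_of_lt (hH.boundE j h1 (Nat.lt_succ_iff.mp hjk) X z g φ hg0 hgγ hφ) (lt_thr_left _ _ _ _)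
    · exact lt_of_le_of_lt (hN.improved.boundE h1 X z g φ hg0 hgγ hφ) (lt_thr_right _ _ _ _)
  · intro j h1 hj X φ hφ
    rcases Nat.lt_succ_iff_lt_or_eq.mp (Nat.lt_succ_of_le hj) with hjk | rfl
    · exact lt_of_le_of_lt (hH.boundR j h1 (Nat.lt_succ_iff.mp hjk) X φ hφ) (lt_thr_left _ _ _ _)
    · exact lt_of_le_of_lt (hN.improved.boundR h1 X φ hφ) (lt_thr_right _ _ _ _)
  · intro j h1 hj X φ a hφ
    rcases Nat.lt_succ_iff_lt_or_eq.mp (Nat.lt_succ_of_le hj) with hjk | rfl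
    · exact lt_of_le_of_lt (hH.boundB j h1 (Nat.lt_succ_iff.mp hjk) X φ a hφ) (lt_thr_left _ _ _ _)
    · exact lt_of_le_of_lt (hN.improved.boundB h1 X φ a hφ) (lt_thr_right _ _ _ _)

omit [CompleteSpace 𝔸] in
/-- **UNIVERSALITY OF THE 𝐄-TERMS TRANSPORTS** (the truncation of `𝐄` reads `𝐄` and the constants only). [cite: Balaban1988Convergent, (2.25)–(2.27) p.259 (bookkeeping)] -/
theorem universalE_spaceTrunc {ι : Type*} {t : ι → Sect2.TermValues P 𝔸 V M} (h : Sect2.UniversalE t) (S : Sect2.Setting 𝔸 G) (n₀ : ℕ) :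
    Sect2.UniversalE (fun i => spaceTrunc S n₀ (t i)) := by
  intro i i'
  funext j X z g φ
  show (spaceTrunc S n₀ (t i)).E j X z g φ = (spaceTrunc S n₀ (t i')).E j X z g φ
  by_cases hj : 1 ≤ j ∧ j ≤ n₀
  · rw [spaceTrunc_E_of S n₀ _ hj, spaceTrunc_E_of S n₀ _ hj, show (t i).E = (t i').E from h i i']
  · rw [spaceTrunc_E_of_not S n₀ _ hj, spaceTrunc_E_of_not S n₀ _ hj]

omit [CompleteSpace 𝔸] in
/-- **`k`-LOCALITY IN THE FLUCTUATION VARIABLES TRANSPORTS** (the truncation of `𝐁` is performed per fluctuation datum). [cite: Balaban1988Convergent, (2.40)–(2.41) p.261 (bookkeeping)] -/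
theorem isFluctLocal_spaceTrunc {k : ℕ} {t : Sect2.TermValues P 𝔸 V M} (h : IsFluctLocal k t) (S : Sect2.Setting 𝔸 G) (n₀ : ℕ) :
    IsFluctLocal k (spaceTrunc S n₀ t) := by
  refine ⟨fun j X u S' a a' ha => ?_⟩
  by_cases hj : 1 ≤ j ∧ j ≤ n₀
  · rw [spaceTrunc_B_of S n₀ t hj, spaceTrunc_B_of S n₀ t hj,
      show (fun ψ => t.B j X ψ (S', a)) = (fun ψ => t.B j X ψ (S', a')) from funext fun ψ => h.B_congr j X ψ S' a a' ha]
  · rw [spaceTrunc_B_of_not S n₀ t hj, spaceTrunc_B_of_not S n₀ t hj]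

end Laws

/-! ## §3  The rows as theorems: Borel measurability and uniform bounds of the truncated terms -/

section Rows

variable {P : Params} {𝔸 : Type*} [NormedRing 𝔸] [NormedAlgebra ℂ 𝔸] {V : Type u} {M : ℕ} {G : Type*} [GaugeGroup G]
variable (S : Sect2.Setting 𝔸 G) (n₀ : ℕ) (t : Sect2.TermValues P 𝔸 V M)

/-- **THE TRUNCATED 𝐄-TERMS ARE BOREL ALONG ANY CONTINUOUS BACKGROUND MAP** (every level, domain, point, coupling). [cite: Balaban1988Convergent, (2.27)(ii) p.259, (2.23) p.258] -/
theorem measurable_re_spaceTrunc_E_comp {X' : Type*} [TopologicalSpace X'] [MeasurableSpace X'] [OpensMeasurableSpace X'] {bg : X' → Sect2.CPair P 𝔸}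
    (hbg : Continuous bg) (j : ℕ) (X : (Sect2.domSys P M j).Dom) (z : Site P j) (g : ℝ) :
    Measurable (fun x => ((spaceTrunc S n₀ t).E j X z g (bg x)).re) := by
  by_cases hj : 1 ≤ j ∧ j ≤ n₀
  · simp only [spaceTrunc_E_of S n₀ t hj]; exact measurable_re_truncC_comp _ _ hbg
  · simp only [spaceTrunc_E_of_not S n₀ t hj, Complex.zero_re]; exact measurable_const

/-- **THE TRUNCATED 𝐑-TERMS ARE BOREL ALONG ANY CONTINUOUS BACKGROUND MAP**. [cite: Balaban1988Convergent, (2.30) p.260, (2.23) p.258] -/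
theorem measurable_re_spaceTrunc_R_comp {X' : Type*} [TopologicalSpace X'] [MeasurableSpace X'] [OpensMeasurableSpace X'] {bg : X' → Sect2.CPair P 𝔸}
    (hbg : Continuous bg) (j : ℕ) (X : (Sect2.domSys P M j).Dom) : Measurable (fun x => ((spaceTrunc S n₀ t).R j X (bg x)).re) := by
  by_cases hj : 1 ≤ j ∧ j ≤ n₀
  · simp only [spaceTrunc_R_of S n₀ t hj]; exact measurable_re_truncC_comp _ _ hbg
  · simp only [spaceTrunc_R_of_not S n₀ t hj, Complex.zero_re]; exact measurable_const

/-- **THE TRUNCATED 𝐁-TERMS ARE BOREL ALONG ANY CONTINUOUS BACKGROUND MAP, PER FLUCTUATION DATUM** (the `a`-dependence carries no law — LOCATED).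
[cite: Balaban1988Convergent, (2.41)(ii) p.261, (2.23) p.258] -/
theorem measurable_re_spaceTrunc_B_comp {X' : Type*} [TopologicalSpace X'] [MeasurableSpace X'] [OpensMeasurableSpace X'] {bg : X' → Sect2.CPair P 𝔸}
    (hbg : Continuous bg) (j : ℕ) (X : (Sect2.domSys P M j).Dom) (a : SFluct P V) : Measurable (fun x => ((spaceTrunc S n₀ t).B j X (bg x) a).re) := by
  by_cases hj : 1 ≤ j ∧ j ≤ n₀
  · simp only [spaceTrunc_B_of S n₀ t hj]; exact measurable_re_truncC_comp _ (fun ψ => t.B j X ψ a) hbg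
  · simp only [spaceTrunc_B_of_not S n₀ t hj, Complex.zero_re]; exact measurable_const

/-- **A UNIFORM BOUND FOR THE TRUNCATED 𝐄-TERMS** (all levels, domains, points, couplings, configurations): the finite sum of the thresholds over the window.
[cite: Balaban1988Convergent, (2.27)(iv) p.259 (bookkeeping)] -/
theorem exists_bound_spaceTrunc_E : ∃ C : ℝ, ∀ (j : ℕ) (X : (Sect2.domSys P M j).Dom) (z : Site P j) (g : ℝ) (φ : Sect2.CPair P 𝔸),
    |((spaceTrunc S n₀ t).E j X z g φ).re| ≤ C := by
  refine ⟨∑ j ∈ Finset.range (n₀ + 1), ∑ X : (Sect2.domSys P M j).Dom, thr S.lf S.βc S.lf.E₀ ((Sect2.domSys P M j).dj X), fun j X z g φ => ?_⟩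
  have hnn : ∀ i ∈ Finset.range (n₀ + 1), 0 ≤ ∑ X : (Sect2.domSys P M i).Dom, thr S.lf S.βc S.lf.E₀ ((Sect2.domSys P M i).dj X) :=
    fun i _ => Finset.sum_nonneg fun X _ => thr_nonneg _ _ _ _
  by_cases hj : 1 ≤ j ∧ j ≤ n₀
  · calc |((spaceTrunc S n₀ t).E j X z g φ).re| ≤ ‖(spaceTrunc S n₀ t).E j X z g φ‖ := Complex.abs_re_le_norm _
      _ ≤ thr S.lf S.βc S.lf.E₀ ((Sect2.domSys P M j).dj X) := norm_spaceTrunc_E_le S n₀ t j X z g φ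
      _ ≤ ∑ X' : (Sect2.domSys P M j).Dom, thr S.lf S.βc S.lf.E₀ ((Sect2.domSys P M j).dj X') :=
          Finset.single_le_sum (f := fun X' => thr S.lf S.βc S.lf.E₀ ((Sect2.domSys P M j).dj X')) (fun X' _ => thr_nonneg _ _ _ _) (Finset.mem_univ X)
      _ ≤ ∑ i ∈ Finset.range (n₀ + 1), ∑ X' : (Sect2.domSys P M i).Dom, thr S.lf S.βc S.lf.E₀ ((Sect2.domSys P M i).dj X') :=
          Finset.single_le_sum (f := fun i => ∑ X' : (Sect2.domSys P M i).Dom, thr S.lf S.βc S.lf.E₀ ((Sect2.domSys P M i).dj X')) hnn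
            (Finset.mem_range.mpr (Nat.lt_succ_of_le hj.2))
  · rw [spaceTrunc_E_of_not S n₀ t hj, Complex.zero_re, abs_zero]
    exact Finset.sum_nonneg hnn

/-- **A UNIFORM BOUND FOR THE TRUNCATED 𝐑-TERMS**. [cite: Balaban1988Convergent, (2.31) p.260 (bookkeeping)] -/
theorem exists_bound_spaceTrunc_R : ∃ C : ℝ, ∀ (j : ℕ) (X : (Sect2.domSys P M j).Dom) (φ : Sect2.CPair P 𝔸), |((spaceTrunc S n₀ t).R j X φ).re| ≤ C := by
  refine ⟨∑ j ∈ Finset.range (n₀ + 1), ∑ X : (Sect2.domSys P M j).Dom, thr S.lf S.βc (S.flow.g j ^ S.lf.κ₀) ((Sect2.domSys P M j).dj X), fun j X φ => ?_⟩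
  have hnn : ∀ i ∈ Finset.range (n₀ + 1), 0 ≤ ∑ X : (Sect2.domSys P M i).Dom, thr S.lf S.βc (S.flow.g i ^ S.lf.κ₀) ((Sect2.domSys P M i).dj X) :=
    fun i _ => Finset.sum_nonneg fun X _ => thr_nonneg _ _ _ _
  by_cases hj : 1 ≤ j ∧ j ≤ n₀
  · calc |((spaceTrunc S n₀ t).R j X φ).re| ≤ ‖(spaceTrunc S n₀ t).R j X φ‖ := Complex.abs_re_le_norm _
      _ ≤ thr S.lf S.βc (S.flow.g j ^ S.lf.κ₀) ((Sect2.domSys P M j).dj X) := norm_spaceTrunc_R_le S n₀ t j X φ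
      _ ≤ ∑ X' : (Sect2.domSys P M j).Dom, thr S.lf S.βc (S.flow.g j ^ S.lf.κ₀) ((Sect2.domSys P M j).dj X') :=
          Finset.single_le_sum (f := fun X' => thr S.lf S.βc (S.flow.g j ^ S.lf.κ₀) ((Sect2.domSys P M j).dj X')) (fun X' _ => thr_nonneg _ _ _ _)
            (Finset.mem_univ X)
      _ ≤ ∑ i ∈ Finset.range (n₀ + 1), ∑ X' : (Sect2.domSys P M i).Dom, thr S.lf S.βc (S.flow.g i ^ S.lf.κ₀) ((Sect2.domSys P M i).dj X') :=
          Finset.single_le_sum (f := fun i => ∑ X' : (Sect2.domSys P M i).Dom, thr S.lf S.βc (S.flow.g i ^ S.lf.κ₀) ((Sect2.domSys P M i).dj X')) hnn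
            (Finset.mem_range.mpr (Nat.lt_succ_of_le hj.2))
  · rw [spaceTrunc_R_of_not S n₀ t hj, Complex.zero_re, abs_zero]
    exact Finset.sum_nonneg hnn

/-- **A UNIFORM BOUND FOR THE TRUNCATED 𝐁-TERMS** (every fluctuation datum). [cite: Balaban1988Convergent, (2.42) p.261 (bookkeeping)] -/
theorem exists_bound_spaceTrunc_B : ∃ C : ℝ, ∀ (j : ℕ) (X : (Sect2.domSys P M j).Dom) (φ : Sect2.CPair P 𝔸) (a : SFluct P V),
    |((spaceTrunc S n₀ t).B j X φ a).re| ≤ C := by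
  refine ⟨∑ j ∈ Finset.range (n₀ + 1), ∑ X : (Sect2.domSys P M j).Dom, thr S.lf S.βc S.lf.B₀ ((Sect2.domSys P M j).dj X), fun j X φ a => ?_⟩
  have hnn : ∀ i ∈ Finset.range (n₀ + 1), 0 ≤ ∑ X : (Sect2.domSys P M i).Dom, thr S.lf S.βc S.lf.B₀ ((Sect2.domSys P M i).dj X) :=
    fun i _ => Finset.sum_nonneg fun X _ => thr_nonneg _ _ _ _
  by_cases hj : 1 ≤ j ∧ j ≤ n₀
  · calc |((spaceTrunc S n₀ t).B j X φ a).re| ≤ ‖(spaceTrunc S n₀ t).B j X φ a‖ := Complex.abs_re_le_norm _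
      _ ≤ thr S.lf S.βc S.lf.B₀ ((Sect2.domSys P M j).dj X) := norm_spaceTrunc_B_le S n₀ t j X φ a
      _ ≤ ∑ X' : (Sect2.domSys P M j).Dom, thr S.lf S.βc S.lf.B₀ ((Sect2.domSys P M j).dj X') :=
          Finset.single_le_sum (f := fun X' => thr S.lf S.βc S.lf.B₀ ((Sect2.domSys P M j).dj X')) (fun X' _ => thr_nonneg _ _ _ _) (Finset.mem_univ X)
      _ ≤ ∑ i ∈ Finset.range (n₀ + 1), ∑ X' : (Sect2.domSys P M i).Dom, thr S.lf S.βc S.lf.B₀ ((Sect2.domSys P M i).dj X') :=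
          Finset.single_le_sum (f := fun i => ∑ X' : (Sect2.domSys P M i).Dom, thr S.lf S.βc S.lf.B₀ ((Sect2.domSys P M i).dj X')) hnn
            (Finset.mem_range.mpr (Nat.lt_succ_of_le hj.2))
  · rw [spaceTrunc_B_of_not S n₀ t hj, Complex.zero_re, abs_zero]
    exact Finset.sum_nonneg hnn

end Rows

end Summit.QuantumFields.YangMills.Theorems.BalabanUVNodesN11SpaceTruncationDefs

end
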